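import Literature.NumberTheory.EllipticCurves.AnticyclotomicSignedTransferTheorem
import Literature.NumberTheory.EllipticCurves.AnticyclotomicSignedSelmerFiniteIndex
import Literature.NumberTheory.EllipticCurves.Kobayashi2003.SignedSelmerDualExistsProofs
import Literature.NumberTheory.EllipticCurves.IwasawaAlgebraRankOneIdealProofs
import Mathlib.LinearAlgebra.Dimension.Torsion.Basic
import HarnessLib

/-!
# Stub S1 `stub_bdpLowerHalfRatSS` of line `bdpline` (crux `AnticyclotomicEisensteinDivisibility`,
# stmt-BirchSwinnertonDyer-20727) — the T68 side hypothesis `hinj`: the compact signed Selmer group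
# `Sel_ε(K, 𝐓^ac)` has `Λ`-rank one, hence `loc_𝔭` is injective on it, CLOSED MODULO TWO EXISTING
# REFEREED TYPED FACTS (Hatley–Lei–Vigni 2022 Prop. 5.7, Longo–Vigni 2019 Thm. 1.4)

Width seat bsd-line-sbc-p1-w3 (gen 2), `--supports stmt-BirchSwinnertonDyer-20727`. On the chain
`S1_coprime ⟸ T68 transfer ⟸ HP-currency Eisenstein divisibility` (lead bsd-line-sbc-p1 gen 4, width
seat bsd-line-sbc-p1-w2 gen 5), the Eisenstein-direction transfer
`SignedBaseChangeAcDivEisensteinTransfer.TransferInputs.span_pow_mul_charIdeal_le_span_sq` (p634573)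
carries two side hypotheses besides the typed `TransferInputs`: `hinj` — `loc_𝔭` is injective on
`Sel_ε(K, 𝐓^ac)` ("`Sel^{str,±}(K, 𝐓^ac) = 0`") — and `hEq`. The tree already proves
`AcSigned.TransferInputs.locSignedAt_injective h hS` from `hS : selmerLambdaAdic.HasRank … (sgn ε) 1`
("`Sel_±(K, 𝐓^ac)` has `Λ^ac`-rank one", Castella–Wan Lemma 6.7 (1) / arXiv v3 Prop. 5.15 — not a
field of `TransferInputs` and not a typed fact). THIS FILE supplies `hS` in the kernel from two
EXISTING refereed typed facts:

* `AcSigned.hatleyLeiVigni2022_prop57_compactSigned_equiv_dual` (Hatley–Lei–Vigni, Manuscripta Math.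
  167 (2022), Prop. 5.7: `Ŝ^±_p(E/K_∞) ≃ Hom_Λ(Sel^±_{p^∞}(E/K_∞)^∨, Λ)`, on the tree's carriers
  `selmerLambdaAdic (W⁄K) p κ γ (sgn ε) ≃ₗ[Λ] Module.Dual Λ D.X` for every Kobayashi dual datum `D`;
  binders `Setting` + conductor + (Heeg) + (Tam) `¬ p ∣ W.tamagawaProduct`);
* `AcSigned.longoVigni2019_thm14_signedSelmerDual_rank_one` (Longo–Vigni, Boll. UMI 12 (2019), Thm.
  1.4: `D.X` finitely generated of `finrank` one; the fact the sub-case (a1) of the line already rests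
  on, `…XAcTorsionOfLongoVigni`, p632902),

at the canonical datum `D = Kobayashi2003.signedSelmerDualData (W⁄K) κ ε hγ`, plus the pure algebra
"the `Λ`-dual of a finitely generated module of rank one over a Noetherian domain is finitely
generated of rank one" (§1, generic). The (Tam) binder is automatic on the all-additive cell at
`p ≥ 5` (Kodaira–Néron: `c_ℓ ≤ 4`) and is an honest extra binder at split multiplicative primes
`ℓ` with `p ∣ v_ℓ(Δ)`; it is carried, not discharged, here.

## Contents (all PROVED, standard axioms; no definition, no new named fact, no `sorry`)

* §1 generic module algebra over a commutative ring `R`: `finite_dual_of_finite` (Noetherian `R`),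
  `exists_anchor_of_finrank_eq_one`, `finrank_dual_eq_one`, `finite_and_finrank_eq_one_of_linearEquiv_dual`
  (domain `R`).
* §2 `hasRank_selmerLambdaAdic_sgn_one_of_facts` — `hS` modulo {HLV22 Prop. 5.7, LV19 Thm. 1.4} in the
  binders of the two facts; `locSignedAt_injective_of_facts` — `hinj` of p634573 modulo the same, for
  every `TransferInputs` datum.
Nothing about elliptic curves is asserted unconditionally: the two facts are hypotheses (`def … : Prop`
of the Literature layer). BSD / the crux / S1 are NOT proved by this file.

References: [HatleyLeiVigni2022] Prop. 5.7 (and §5.1 (Tam)); [LongoVigni2019] Thm. 1.4;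
[CastellaWan2023] Lemma 6.7 (1) and proof of Thm. 6.8 (MS p. 30) = arXiv:1607.02019v3 Prop. 5.15,
Lemma 5.10 (eq. (5.9)–(5.10)); [BourbakiAC5to7] Ch. VII §4 no. 1–2 (rank, duals of lattices).
-/

-- D-0017: single-problem summit, the namespace repeats the problem name by design.
set_option linter.dupNamespace false
set_option autoImplicit false

noncomputable section

open scoped Classical

universe u

namespace Summit.BirchSwinnertonDyer.BirchSwinnertonDyer.Theorems.SignedBaseChangeAcDivCompactSignedRank

/-! ## §1 The dual of a finitely generated module of rank one (generic) -/

section Algebra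

variable {R : Type*} [CommRing R] {M : Type*} [AddCommGroup M] [Module R M]

/-- **The dual `Hom_R(M, R)` of a finitely generated module over a Noetherian ring is finitely
generated**: a surjection `Rⁿ ↠ M` makes `Hom(M, R) ↪ Hom(Rⁿ, R) ≅ Rⁿ` a submodule of a Noetherian
module. [cite: BourbakiAC5to7, Ch. VII §4 no. 2] -/
theorem finite_dual_of_finite [IsNoetherianRing R] [Module.Finite R M] :
    Module.Finite R (Module.Dual R M) := by
  obtain ⟨n, f, hf⟩ := Module.Finite.exists_fin' R M
  exact Module.Finite.of_injective _ (LinearMap.dualMap_injective_of_surjective hf)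

/-- **An anchor of a rank-one module.** In a finitely generated module `M` of rank one over a domain
there is an `x₀ ∈ M` to which every element is tied by a relation `a • m = b • x₀` with `a ≠ 0`, and
which is not killed by some linear functional `φ₀ : M → R` (work in the torsion-free quotient
`M ⧸ M_tors`, of rank one: there a non-zero `y₀` ties every class
(`Module.exists_smul_eq_smul_of_rank_le_one`) and an injective functional exists
(`Module.exists_injective_linearMap_of_rank_le_one`); lift the relations to `M` by clearing the
torsion with a non-zero-divisor). [cite: BourbakiAC5to7, Ch. VII §4 no. 1] -/
theorem exists_anchor_of_finrank_eq_one [IsDomain R] [Module.Finite R M]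
    (h : Module.finrank R M = 1) :
    ∃ x₀ : M, (∀ m : M, ∃ a b : R, a ≠ 0 ∧ a • m = b • x₀) ∧
      ∃ φ₀ : Module.Dual R M, φ₀ x₀ ≠ 0 := by
  have hrk : Module.rank R M = 1 := by
    have := (Cardinal.toNat_eq_iff one_ne_zero).1 h
    exact_mod_cast this
  set N := Submodule.torsion R M with hN
  have hrk' : Module.rank R (M ⧸ N) = 1 := by rw [rank_quotient_eq_of_le_torsion le_rfl, hrk]
  have hle : Module.rank R (M ⧸ N) ≤ 1 := hrk'.le
  -- a non-zero element of the torsion-free quotient and an injective functional on it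
  obtain ⟨y₀, hy₀⟩ : ∃ y : M ⧸ N, y ≠ 0 :=
    rank_pos_iff_exists_ne_zero.1 (by rw [hrk']; exact zero_lt_one)
  obtain ⟨ψ, hψ⟩ :=
    Literature.NumberTheory.EllipticCurves.Module.exists_injective_linearMap_of_rank_le_one
      (R := R) (M := M ⧸ N) hle
  obtain ⟨x₀, rfl⟩ := Submodule.mkQ_surjective N y₀
  refine ⟨x₀, fun m ↦ ?_, ⟨ψ ∘ₗ N.mkQ, fun h0 ↦ hy₀ (hψ (by rw [map_zero]; exact h0))⟩⟩
  obtain ⟨a, b, ha, hab⟩ :=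
    Literature.NumberTheory.EllipticCurves.Module.exists_smul_eq_smul_of_rank_le_one hle hy₀ (N.mkQ m)
  have hmem : a • m - b • x₀ ∈ N := by
    rw [← Submodule.Quotient.mk_eq_zero, ← Submodule.mkQ_apply, map_sub, map_smul, map_smul, hab,
      sub_self]
  obtain ⟨⟨c, hc⟩, hcm⟩ := (Submodule.mem_torsion_iff _).1 hmem
  refine ⟨c * a, c * b, mul_ne_zero (nonZeroDivisors.ne_zero hc) ha, ?_⟩
  have : c • (a • m - b • x₀) = 0 := hcm
  rw [smul_sub, sub_eq_zero, smul_smul, smul_smul] at this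
  exact this

/-- **The dual of a finitely generated module of rank one over a domain has rank one**
(`Module.finrank R (Module.Dual R M) = 1`): with an anchor `x₀`, every functional vanishing at `x₀`
vanishes, so any two functionals `φ, ψ` satisfy the relation `ψ(x₀)·φ − φ(x₀)·ψ = 0` (rank `≤ 1`,
`rank_le`), while `φ₀ ≠ 0` in the torsion-free dual gives rank `≥ 1`. The shape in which "`X_±` has
`Λ`-rank one" (Longo–Vigni) passes to "`Hom_Λ(X_±, Λ) ≃ Sel_±(K, 𝐓^ac)` has `Λ`-rank one".
[cite: BourbakiAC5to7, Ch. VII §4 no. 2] -/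
theorem finrank_dual_eq_one [IsDomain R] [Module.Finite R M] (h : Module.finrank R M = 1) :
    Module.finrank R (Module.Dual R M) = 1 := by
  obtain ⟨x₀, hx₀, φ₀, hφ₀⟩ := exists_anchor_of_finrank_eq_one h
  -- every functional vanishing at `x₀` vanishes
  have hvan : ∀ φ : Module.Dual R M, φ x₀ = 0 → φ = 0 := by
    intro φ hφ
    ext m
    obtain ⟨a, b, ha, hab⟩ := hx₀ m
    have : a * φ m = 0 := by
      rw [← smul_eq_mul, ← map_smul, hab, map_smul, hφ, smul_zero]
    exact (mul_eq_zero.1 this).resolve_left ha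
  apply Module.finrank_eq_of_rank_eq
  apply le_antisymm
  · -- rank ≤ 1: two functionals are dependent
    apply rank_le
    intro s hs
    by_contra hcard
    push Not at hcard
    obtain ⟨φ, hφs, ψ, hψs, hne⟩ := Finset.one_lt_card.1 hcard
    -- the pair `(φ, ψ)` is linearly independent
    have hpair : LinearIndependent R ![(φ : Module.Dual R M), ψ] := by
      have := hs.comp (fun i : Fin 2 ↦ (⟨![φ, ψ] i, by fin_cases i <;> simpa⟩ : s)) (by
        intro i j hij
        fin_cases i <;> fin_cases j <;> simp_all)
      convert this using 1
      ext i
      fin_cases i <;> rfl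
    rw [LinearIndependent.pair_iff] at hpair
    have hrel : ψ x₀ • φ + (-(φ x₀)) • ψ = 0 := by
      apply hvan
      simp [mul_comm]
    obtain ⟨-, h2⟩ := hpair _ _ hrel
    exact hs.ne_zero ⟨φ, hφs⟩ (hvan φ (neg_eq_zero.1 h2))
  · -- rank ≥ 1: `φ₀ ≠ 0` in the torsion-free dual
    rw [Nat.cast_one, Cardinal.one_le_iff_pos, rank_pos_iff_exists_ne_zero]
    exact ⟨φ₀, fun h0 ↦ hφ₀ (by rw [h0, LinearMap.zero_apply])⟩

/-- **Transport**: a `Λ`-module linearly isomorphic to the dual of a finitely generated module of rank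
one (over a Noetherian domain) is finitely generated of `finrank` one. [cite: BourbakiAC5to7, Ch. VII §4 no. 2] -/
theorem finite_and_finrank_eq_one_of_linearEquiv_dual [IsDomain R] [IsNoetherianRing R]
    {S : Type*} [AddCommGroup S] [Module R S] {X : Type*} [AddCommGroup X] [Module R X]
    [Module.Finite R X] (hX : Module.finrank R X = 1) (e : S ≃ₗ[R] Module.Dual R X) :
    Module.Finite R S ∧ Module.finrank R S = 1 := by
  haveI : Module.Finite R (Module.Dual R X) := finite_dual_of_finite
  exact ⟨Module.Finite.equiv e.symm, by rw [e.finrank_eq, finrank_dual_eq_one hX]⟩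

end Algebra

/-! ## §2 `Sel_ε(K, 𝐓^ac)` has `Λ`-rank one; `loc_𝔭` is injective on it -/

section Arithmetic

open NumberField IsDedekindDomain Field
open Literature.NumberTheory.EllipticCurves Literature.NumberTheory.GaloisRepresentations
open Literature.NumberTheory.EllipticCurves.AcSigned Literature.NumberTheory.EllipticCurves.Kobayashi2003

variable {W : WeierstrassCurve ℚ} [W.IsGloballyMinimal] {K : Type} [Field K] [NumberField K]
  {p : ℕ} [Fact p.Prime] {κ : ZpExtension K p} {𝔭 𝔭' : HeightOneSpectrum (𝓞 K)}

/-- **`Sel_ε(K, 𝐓^ac)` is finitely generated of `Λ`-rank ONE** (`selmerLambdaAdic.HasRank (W⁄K) p κ γ hγ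
(sgn ε) 1` — Castella–Wan Lemma 6.7 (1) "`X_±` and `Sel_±(K, 𝐓^ac)` have the same `Λ^ac`-rank" combined
with rank one of `X_±`), GRANTED the two refereed typed facts Hatley–Lei–Vigni 2022 Prop. 5.7
(`Sel_ε(K, 𝐓^ac) ≃ₗ Hom_Λ(X^ε, Λ)`) and Longo–Vigni 2019 Thm. 1.4 (`X^ε` of rank one), both read at
Kobayashi's canonical dual datum `signedSelmerDualData (W⁄K) κ ε hγ`; binders = the union of the two
facts' binders (`Setting`, conductor `N > 3` with (Heeg), `5 ≤ p`, no CM, `ρ_{E,p}` onto, (Tam)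
`p ∤ ∏ c_ℓ`). The input `hS`/`hrank` of `AcSigned.TransferInputs.locSignedAt_injective` and of
`AcSigned.TransferInputs.isFGTorsion_and_sq_mem_charIdeal`.
[cite: HatleyLeiVigni2022, Prop. 5.7] [cite: LongoVigni2019, Thm. 1.4]
[cite: CastellaWan2023, Lemma 6.7 (1) (MS p. 28)] -/
theorem hasRank_selmerLambdaAdic_sgn_one_of_facts
    (h57 : hatleyLeiVigni2022_prop57_compactSigned_equiv_dual W K p κ 𝔭 𝔭')
    (h14 : longoVigni2019_thm14_signedSelmerDual_rank_one W K p κ 𝔭 𝔭')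
    (hS : Setting W K p κ 𝔭 𝔭') {N : ℕ} (hN : (W.conductorNorm ℤ : ℕ) = N) (h3N : 3 < N)
    (hHg : SatisfiesHeegnerHypothesis N K) (hp : 5 ≤ p) (hCM : ¬ W.HasCM)
    (hbig : ∀ f : Module.End ℤ_[p] (W.tateModule p), IsUnit f → f ∈ Set.range (W.galoisRepTate p))
    (hTam : ¬ p ∣ W.tamagawaProduct)
    {γ : absoluteGaloisGroup K} (hγ : κ.IsTopGenerator γ) (ε : ℤˣ) :
    selmerLambdaAdic.HasRank (W.baseChange K) p κ γ hγ (fun _ ↦ .sgn ε) 1 := by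
  letI := selmerLambdaAdic.moduleOfGen (W.baseChange K) p κ γ hγ (fun _ ↦ PCond.sgn ε)
  obtain ⟨e⟩ := h57 hS N hN hHg hTam γ hγ ε (signedSelmerDualData (W.baseChange K) κ ε hγ)
  obtain ⟨hfin, hrk⟩ := h14 hS N hN h3N hHg hp hCM hbig γ hγ ε
    (signedSelmerDualData (W.baseChange K) κ ε hγ)
  haveI := hfin
  exact finite_and_finrank_eq_one_of_linearEquiv_dual hrk e

/-- **`hinj` of the Eisenstein-direction transfer, modulo the two facts: `loc_𝔭` is INJECTIVE on
`Sel_ε(K, 𝐓^ac)`** ("`Sel^{str,±}(K, 𝐓^ac) = 0`, Castella–Wan, proof of Thm. 6.8: "the non-vanishing of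
`loc_𝔭` and the equality `rank_{Λac}(Sel_±(K, 𝐓^ac)) = 1` implies that `Sel^{str,±}(K, 𝐓^ac) = 0`") for
every `TransferInputs` datum at `(𝔭, 𝔭')` — the tree's `TransferInputs.locSignedAt_injective` fed with
`hasRank_selmerLambdaAdic_sgn_one_of_facts`. This is the hypothesis `hinj` of
`SignedBaseChangeAcDivEisensteinTransfer.TransferInputs.span_pow_mul_charIdeal_le_span_sq` (p634573).
[cite: CastellaWan2023, proof of Thm. 6.8 (MS p. 30)] [cite: HatleyLeiVigni2022, Prop. 5.7]
[cite: LongoVigni2019, Thm. 1.4] -/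
theorem locSignedAt_injective_of_facts
    (h57 : hatleyLeiVigni2022_prop57_compactSigned_equiv_dual W K p κ 𝔭 𝔭')
    (h14 : longoVigni2019_thm14_signedSelmerDual_rank_one W K p κ 𝔭 𝔭')
    (hS : Setting W K p κ 𝔭 𝔭') {N : ℕ} (hN : (W.conductorNorm ℤ : ℕ) = N) (h3N : 3 < N)
    (hHg : SatisfiesHeegnerHypothesis N K) (hp : 5 ≤ p) (hCM : ¬ W.HasCM)
    (hbig : ∀ f : Module.End ℤ_[p] (W.tateModule p), IsUnit f → f ∈ Set.range (W.galoisRepTate p))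
    (hTam : ¬ p ∣ W.tamagawaProduct)
    {γ : absoluteGaloisGroup K} {hγ : κ.IsTopGenerator γ} {h𝔭 : IsNonsplitIn κ 𝔭}
    {γ𝔭 : absoluteGaloisGroup (𝔭.adicCompletion K)}
    {hγ𝔭 : κ (resGalOfEmb (closureEmb (K := K) (𝔭.adicCompletion K)) γ𝔭) = κ γ}
    {h𝔭𝔭' : 𝔭 ≠ 𝔭'} {h𝔭p : ((p : ℕ) : 𝓞 K) ∈ 𝔭.asIdeal} {ε : ℤˣ}
    {z : selmerLambdaAdic (W.baseChange K) p κ γ (fun _ ↦ .sgn ε)} {L : UnrSeries p}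
    (hT : TransferInputs (W.baseChange K) p κ γ hγ 𝔭 h𝔭 γ𝔭 hγ𝔭 𝔭' h𝔭𝔭' h𝔭p ε z L) :
    Function.Injective
      (locSignedAt (W.baseChange K) p κ 𝔭 h𝔭 γ γ𝔭 hγ𝔭 (fun _ ↦ .sgn ε) ε rfl h𝔭p) :=
  haveI : (W.baseChange K).IsElliptic := by
    haveI := hS.isElliptic; rw [WeierstrassCurve.baseChange]; infer_instance
  hT.locSignedAt_injective
    (hasRank_selmerLambdaAdic_sgn_one_of_facts h57 h14 hS hN h3N hHg hp hCM hbig hTam hγ ε)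

end Arithmetic

end Summit.BirchSwinnertonDyer.BirchSwinnertonDyer.Theorems.SignedBaseChangeAcDivCompactSignedRank

end
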